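import Literature.Probability.RandomPlanarGeometry.ChordalBoundary
import Literature.Probability.RandomPlanarGeometry.ConformalRectangleProofs
import HarnessLib

/-!
# Boundary correspondence of uniformizing data of conformal rectangles: intervals ↦ arcs

Topic `Literature/Probability/RandomPlanarGeometry`. For a uniformizing datum `(ψ, x)` of a
conformal rectangle `R = (Ω; a, b, c, d)` (`MarkedDomain.IsUniformizing`: `ψ : ℍₒ → Ω` conformal
with boundary value `R.pt i` at the real point `x i`, `x` strictly monotone or antitone) the
boundary extension `Ψ = ψ.boundaryExtension` maps the real segment between `x i` and `x (i+1)`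
ONTO the boundary arc `R.arc i` (`i = 0, 1, 2`), the two unbounded pieces of `ℝ` and the point
at infinity into the fourth arc `R.arc 3` (Carathéodory's theorem; Pommerenke, *Boundary
Behaviour of Conformal Maps* (1992), Thm. 2.6 and Cor. 2.7 — the boundary correspondence is a
homeomorphism of circles preserving the cyclic order). Everything here is PROVED from the tree's
disc form of Carathéodory's theorem (`JordanDomain.exists_continuousOn_extension_holds`) through
the pulled-back boundary parametrisation `JordanDomain.discParam` of `ChordalBoundary.lean`:

* `UniformizingArcs.image_uIcc_eq_arc_zero/one/two` — `Ψ '' [x i, x (i+1)] = R.arc i`;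
* `UniformizingArcs.mem_arc_three_of_not_mem_uIoo` — `Ψ y ∈ R.arc 3` for real `y` outside the
  open segment between `x 0` and `x 3`;
* `UniformizingArcs.apply_one_mem_arc_three` — the boundary value at infinity `Φ 1` lies on
  `R.arc 3`;
* `UniformizingArcs.eq_or_exists_of_mem_arc_three` — conversely every point of `R.arc 3` is
  `Φ 1` or `Ψ y` with `y` outside that open segment.

These feed the comparison map of the variational proof of `ShearCrossRatioAnalytic`
(`ShearModulusAnalytic.lean`).

## References

* Ch. Pommerenke, *Boundary Behaviour of Conformal Maps*, Springer (1992), Thm. 2.6, Cor. 2.7.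
* W. Werner, *Lectures on two-dimensional critical percolation* (2007), §3. [folklore]
-/

noncomputable section

open Set Filter Topology Complex Metric
open UpperHalfPlane (upperHalfPlaneSet)

namespace Literature.Probability.RandomPlanarGeometry

namespace UniformizingArcs

/-! ### Order bookkeeping for a strictly monotone-or-antitone map on a window -/

/-- For `g` strictly monotone or antitone on `W` and `a ≤ b` in `W`, `t ∈ W`:
`g t ∈ [g a, g b]` (unordered) iff `t ∈ [a, b]`. [folklore] -/
theorem mem_uIcc_iff {g : ℝ → ℝ} {W : Set ℝ} (hg : StrictMonoOn g W ∨ StrictAntiOn g W)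
    {a b t : ℝ} (ha : a ∈ W) (hb : b ∈ W) (ht : t ∈ W) (hab : a ≤ b) :
    g t ∈ uIcc (g a) (g b) ↔ t ∈ Icc a b := by
  rcases hg with hg | hg
  · rw [uIcc_of_le (hg.monotoneOn ha hb hab), mem_Icc, mem_Icc, hg.le_iff_le ha ht,
      hg.le_iff_le ht hb]
  · rw [uIcc_of_ge (hg.antitoneOn ha hb hab), mem_Icc, mem_Icc, hg.le_iff_ge hb ht,
      hg.le_iff_ge ht ha, and_comm]

/-- Same for open intervals: `g t ∈ (g a, g b)` (unordered) iff `t ∈ (a, b)`. [folklore] -/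
theorem mem_uIoo_iff {g : ℝ → ℝ} {W : Set ℝ} (hg : StrictMonoOn g W ∨ StrictAntiOn g W)
    {a b t : ℝ} (ha : a ∈ W) (hb : b ∈ W) (ht : t ∈ W) (hab : a ≤ b) :
    g t ∈ uIoo (g a) (g b) ↔ t ∈ Ioo a b := by
  rcases hg with hg | hg
  · rw [uIoo_of_le (hg.monotoneOn ha hb hab), mem_Ioo, mem_Ioo, hg.lt_iff_lt ha ht,
      hg.lt_iff_lt ht hb]
  · rw [uIoo_of_ge (hg.antitoneOn ha hb hab), mem_Ioo, mem_Ioo, hg.lt_iff_gt hb ht,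
      hg.lt_iff_gt ht ha, and_comm]

/-! ### The window of parameters not mapped to the boundary value at infinity -/

variable {R : ConformalRectangle} {ψ : ConformalEquiv upperHalfPlaneSet R.carrier} {x : Fin 4 → ℝ}
  {Φ : ℂ → ℂ}

/-- The arc `(ab)` is `boundary [mark 0, mark 1]`. [folklore] -/
theorem arc_zero_eq (R : ConformalRectangle) : R.arc 0 = R.boundary '' Icc (R.mark 0) (R.mark 1) := by
  rw [MarkedDomain.arc, MarkedDomain.nextMark, dif_pos (by decide)]
  rfl

/-- The arc `(da)` is `boundary [mark 3, mark 0 + 1]`. [folklore] -/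
theorem arc_three_eq (R : ConformalRectangle) :
    R.arc 3 = R.boundary '' Icc (R.mark 3) (R.mark 0 + 1) := by
  rw [MarkedDomain.arc, MarkedDomain.nextMark, dif_neg (by decide)]
  rfl

/-- The boundary extension takes the marked value at the marked preimage: `Ψ (x i) = pt i`.
[folklore] -/
theorem boundaryExtension_apply_eq_pt (hψ : R.IsUniformizing ψ x) (i : Fin 4) :
    ψ.boundaryExtension (x i) = R.pt i :=
  JordanDomain.boundaryExtension_eq_of_hasBoundaryValue' ψ (by simp) (hψ.2 i)

section Window

variable (h : JordanDomain.IsDiscExtension R.toJordanDomain ψ Φ) {T : ℝ}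
  (hT : R.boundary T = Φ 1)
include h hT

omit h in
/-- Inside the window `(T - 1, T)` no parameter is mapped to `Φ 1 = boundary T`. [folklore] -/
theorem boundary_ne_apply_one {t : ℝ} (ht : t ∈ Ioo (T - 1) T) : R.boundary t ≠ Φ 1 := by
  rw [← hT, ← R.periodic_boundary.sub_eq T]
  intro heq
  have := R.injOn_boundary_Ico (T - 1) ⟨ht.1.le, by linarith [ht.2]⟩ ⟨le_rfl, by linarith⟩ heq
  exact ht.1.ne' this

/-- The pulled-back parametrisation is strictly monotone or antitone on the window. [folklore] -/
theorem strictMonoOn_or_strictAntiOn :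
    StrictMonoOn (JordanDomain.discParam R.toJordanDomain Φ) (Ioo (T - 1) T) ∨
      StrictAntiOn (JordanDomain.discParam R.toJordanDomain Φ) (Ioo (T - 1) T) := by
  have hc : ContinuousOn (JordanDomain.discParam R.toJordanDomain Φ) (Ioo (T - 1) T) :=
    h.continuousOn_discParam.mono fun _ ht ↦ boundary_ne_apply_one hT ht
  have hinj : InjOn (JordanDomain.discParam R.toJordanDomain Φ) (Ioo (T - 1) T) := by
    intro t ht s hs hts
    have key : R.boundary t = R.boundary s := by
      rw [← h.boundaryExtension_discParam (boundary_ne_apply_one hT ht),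
        ← h.boundaryExtension_discParam (boundary_ne_apply_one hT hs)]
      exact congrArg _ (congrArg _ hts)
    exact R.injOn_boundary_Ico (T - 1) ⟨ht.1.le, by linarith [ht.2]⟩
      ⟨hs.1.le, by linarith [hs.2]⟩ key
  exact hc.strictMonoOn_of_injOn_Ioo (by linarith) hinj

/-- Every real `y` is `discParam t` for some `t` in the window, with `boundary t = Ψ y`.
[folklore] -/
theorem exists_mem_Ioo_discParam_eq (y : ℝ) : ∃ t ∈ Ioo (T - 1) T,
    R.boundary t = ψ.boundaryExtension y ∧ JordanDomain.discParam R.toJordanDomain Φ t = y := by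
  obtain ⟨t, ht, hbt, hpt⟩ := h.exists_mem_Ico_discParam_eq y (T - 1)
  refine ⟨t, ⟨ht.1.lt_of_ne ?_, by linarith [ht.2]⟩, hbt, hpt⟩
  rintro rfl
  refine h.boundaryExtension_ofReal_ne y ?_
  rw [← hbt, R.periodic_boundary.sub_eq, hT]

/-- **Images of parameter intervals inside the window**: for `a ≤ b` with `[a, b] ⊆ (T-1, T)`,
`Ψ '' [g a, g b] = boundary '' [a, b]` (`g = discParam`). [folklore] -/
theorem image_uIcc_discParam_eq {a b : ℝ} (hab : a ≤ b) (ha : T - 1 < a) (hb : b < T) :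
    (fun y : ℝ => ψ.boundaryExtension y) '' uIcc (JordanDomain.discParam R.toJordanDomain Φ a)
        (JordanDomain.discParam R.toJordanDomain Φ b) = R.boundary '' Icc a b := by
  have hg := strictMonoOn_or_strictAntiOn h hT
  have haW : a ∈ Ioo (T - 1) T := ⟨ha, lt_of_le_of_lt hab hb⟩
  have hbW : b ∈ Ioo (T - 1) T := ⟨lt_of_lt_of_le ha hab, hb⟩
  apply Subset.antisymm
  · rintro _ ⟨y, hy, rfl⟩
    obtain ⟨t, htW, hbt, hgt⟩ := exists_mem_Ioo_discParam_eq h hT y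
    rw [← hgt] at hy
    have ht : t ∈ Icc a b := (mem_uIcc_iff hg haW hbW htW hab).1 hy
    exact ⟨t, ht, hbt⟩
  · rintro _ ⟨t, ht, rfl⟩
    have htW : t ∈ Ioo (T - 1) T := ⟨lt_of_lt_of_le ha ht.1, lt_of_le_of_lt ht.2 hb⟩
    refine ⟨JordanDomain.discParam R.toJordanDomain Φ t, (mem_uIcc_iff hg haW hbW htW hab).2 ht, ?_⟩
    exact h.boundaryExtension_discParam (boundary_ne_apply_one hT htW)

variable (hψ : R.IsUniformizing ψ x)
include hψ

omit hT in
/-- A parameter of the marked point `pt i` inside the window is pulled back to `x i`. [folklore] -/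
theorem discParam_eq_of_boundary_eq_pt {t : ℝ} {i : Fin 4} (ht : R.boundary t = R.pt i) :
    JordanDomain.discParam R.toJordanDomain Φ t = x i :=
  h.discParam_eq (ht.trans (boundaryExtension_apply_eq_pt hψ i).symm)

omit hT in
/-- The parameter `T` of `Φ 1` is not a mark. [folklore] -/
theorem ne_mark (hT : R.boundary T = Φ 1) (i : Fin 4) : T ≠ R.mark i := by
  rintro rfl
  have h1 : ψ.boundaryExtension (x i) = Φ 1 := by
    rw [boundaryExtension_apply_eq_pt hψ, ← hT]; rfl
  exact h.boundaryExtension_ofReal_ne (x i) h1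

omit h hT in
/-- Order contradiction: two comparisons of preimages in the direction of `g` that no
strictly monotone or antitone `x` can satisfy. [folklore] -/
theorem false_of_pairs {i j k l : Fin 4} (hij : i < j) (hlk : l < k)
    (hc : (x i < x j ∧ x k < x l) ∨ (x j < x i ∧ x l < x k)) : False := by
  rcases hψ.1 with hx | hx
  · rcases hc with ⟨-, h2⟩ | ⟨h1, -⟩
    · exact lt_asymm h2 (hx hlk)
    · exact lt_asymm h1 (hx hij)
  · rcases hc with ⟨h1, -⟩ | ⟨-, h2⟩
    · exact lt_asymm h1 (hx hij)
    · exact lt_asymm h2 (hx hlk)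

omit hT in
/-- Comparison of two parameters of marked points inside the window, in the direction of `g`.
[folklore] -/
theorem compare_of_lt {s s' : ℝ} {i j : Fin 4} (hs : s ∈ Ioo (T - 1) T) (hs' : s' ∈ Ioo (T - 1) T)
    (hss' : s < s') (hi : R.boundary s = R.pt i) (hj : R.boundary s' = R.pt j) :
    (StrictMonoOn (JordanDomain.discParam R.toJordanDomain Φ) (Ioo (T - 1) T) → x i < x j) ∧
      (StrictAntiOn (JordanDomain.discParam R.toJordanDomain Φ) (Ioo (T - 1) T) → x j < x i) := by
  constructor
  · intro hg
    have := hg hs hs' hss'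
    rwa [discParam_eq_of_boundary_eq_pt h hψ hi, discParam_eq_of_boundary_eq_pt h hψ hj] at this
  · intro hg
    have := hg hs hs' hss'
    rwa [discParam_eq_of_boundary_eq_pt h hψ hi, discParam_eq_of_boundary_eq_pt h hψ hj] at this

/-- **The boundary value at infinity lies beyond the last mark**: if `boundary T = Φ 1` with
`T ∈ [mark 0, mark 0 + 1)`, then `mark 3 < T` (cyclic order of the boundary correspondence).
[folklore] -/
theorem mark_three_lt (hT0 : R.mark 0 ≤ T) (hT1 : T < R.mark 0 + 1) : R.mark 3 < T := by
  have hm01 : R.mark 0 < R.mark 1 := R.strictMono_mark (by decide)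
  have hm12 : R.mark 1 < R.mark 2 := R.strictMono_mark (by decide)
  have hm23 : R.mark 2 < R.mark 3 := R.strictMono_mark (by decide)
  have hm3 : R.mark 3 < 1 := (R.mark_mem 3).2
  have hm0 : 0 ≤ R.mark 0 := (R.mark_mem 0).1
  have hT0' : R.mark 0 < T := hT0.lt_of_ne (ne_mark h hψ hT 0).symm
  have hg := strictMonoOn_or_strictAntiOn h hT
  -- parameters of the marked points, shifted by one period
  have hb : ∀ i : Fin 4, R.boundary (R.mark i - 1) = R.pt i := fun i =>
    R.periodic_boundary.sub_eq (R.mark i)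
  have hb' : ∀ i : Fin 4, R.boundary (R.mark i) = R.pt i := fun i => rfl
  by_contra hT3
  have hT3 : T ≤ R.mark 3 := not_lt.1 hT3
  have hT3' : T < R.mark 3 := hT3.lt_of_ne (ne_mark h hψ hT 3)
  -- the pair `(mark 3 - 1, mark 0)` is always in the window, in this order
  have h30W : R.mark 3 - 1 ∈ Ioo (T - 1) T ∧ R.mark 0 ∈ Ioo (T - 1) T :=
    ⟨⟨by linarith, by linarith⟩, ⟨by linarith, hT0'⟩⟩
  have hP2 := compare_of_lt h hψ (T := T) h30W.1 h30W.2 (by linarith) (hb 3) (hb' 0)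
  rcases lt_or_ge T (R.mark 1) with hc1 | hc1
  · -- `mark 0 < T < mark 1`: pair `(mark 1 - 1, mark 2 - 1)`
    have hP1 := compare_of_lt h hψ (T := T) (i := 1) (j := 2) ⟨by linarith, by linarith⟩
      ⟨by linarith, by linarith⟩ (by linarith) (hb 1) (hb 2)
    rcases hg with hg | hg
    · exact false_of_pairs hψ (i := 1) (j := 2) (k := 3) (l := 0) (by decide) (by decide)
        (Or.inl ⟨hP1.1 hg, hP2.1 hg⟩)
    · exact false_of_pairs hψ (i := 1) (j := 2) (k := 3) (l := 0) (by decide) (by decide)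
        (Or.inr ⟨hP1.2 hg, hP2.2 hg⟩)
  have hc1' : R.mark 1 < T := hc1.lt_of_ne (ne_mark h hψ hT 1).symm
  rcases lt_or_ge T (R.mark 2) with hc2 | hc2
  · -- `mark 1 < T < mark 2`: pair `(mark 2 - 1, mark 3 - 1)`
    have hP1 := compare_of_lt h hψ (T := T) (i := 2) (j := 3) ⟨by linarith, by linarith⟩
      ⟨by linarith, by linarith⟩ (by linarith) (hb 2) (hb 3)
    rcases hg with hg | hg
    · exact false_of_pairs hψ (i := 2) (j := 3) (k := 3) (l := 0) (by decide) (by decide)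
        (Or.inl ⟨hP1.1 hg, hP2.1 hg⟩)
    · exact false_of_pairs hψ (i := 2) (j := 3) (k := 3) (l := 0) (by decide) (by decide)
        (Or.inr ⟨hP1.2 hg, hP2.2 hg⟩)
  have hc2' : R.mark 2 < T := hc2.lt_of_ne (ne_mark h hψ hT 2).symm
  -- `mark 2 < T < mark 3`: pair `(mark 0, mark 1)`
  have hP1 := compare_of_lt h hψ (T := T) (i := 0) (j := 1) ⟨by linarith, hT0'⟩
    ⟨by linarith, by linarith⟩ hm01 (hb' 0) (hb' 1)
  rcases hg with hg | hg
  · exact false_of_pairs hψ (i := 0) (j := 1) (k := 3) (l := 0) (by decide) (by decide)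
      (Or.inl ⟨hP1.1 hg, hP2.1 hg⟩)
  · exact false_of_pairs hψ (i := 0) (j := 1) (k := 3) (l := 0) (by decide) (by decide)
      (Or.inr ⟨hP1.2 hg, hP2.2 hg⟩)

end Window

/-! ### The arc correspondence -/

section Arcs

variable (h : JordanDomain.IsDiscExtension R.toJordanDomain ψ Φ) (hψ : R.IsUniformizing ψ x)
include h hψ

/-- The parameter of the boundary value at infinity: `boundary T = Φ 1` with
`mark 3 < T < mark 0 + 1`. [folklore] -/
theorem exists_param_apply_one :
    ∃ T, R.mark 3 < T ∧ T < R.mark 0 + 1 ∧ R.boundary T = Φ 1 := by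
  have h1 : Φ 1 ∈ frontier R.carrier :=
    h.bijOn_sphere.mapsTo (mem_sphere_zero_iff_norm.2 (by simp))
  obtain ⟨T, hTI, hT⟩ := R.toJordanDomain.exists_mem_Ico_boundary_eq h1 (R.mark 0)
  exact ⟨T, mark_three_lt h hT hψ hTI.1 hTI.2, hTI.2, hT⟩

/-- **`Ψ` maps `[x 0, x 1]` onto the arc `(ab)`.** [folklore] -/
theorem image_uIcc_eq_arc_zero :
    (fun y : ℝ => ψ.boundaryExtension y) '' uIcc (x 0) (x 1) = R.arc 0 := by
  obtain ⟨T, h3, h1, hT⟩ := exists_param_apply_one h hψ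
  have hm01 : R.mark 0 < R.mark 1 := R.strictMono_mark (by decide)
  have hm13 : R.mark 1 < R.mark 3 := R.strictMono_mark (by decide)
  rw [← discParam_eq_of_boundary_eq_pt h hψ (rfl : R.boundary (R.mark 0) = R.pt 0),
    ← discParam_eq_of_boundary_eq_pt h hψ (rfl : R.boundary (R.mark 1) = R.pt 1),
    image_uIcc_discParam_eq h hT hm01.le (by linarith) (by linarith), arc_zero_eq]

/-- **`Ψ` maps `[x 1, x 2]` onto the arc `(bc)`.** [folklore] -/
theorem image_uIcc_eq_arc_one :
    (fun y : ℝ => ψ.boundaryExtension y) '' uIcc (x 1) (x 2) = R.arc 1 := by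
  obtain ⟨T, h3, h1, hT⟩ := exists_param_apply_one h hψ
  have hm01 : R.mark 0 < R.mark 1 := R.strictMono_mark (by decide)
  have hm12 : R.mark 1 < R.mark 2 := R.strictMono_mark (by decide)
  have hm23 : R.mark 2 < R.mark 3 := R.strictMono_mark (by decide)
  rw [← discParam_eq_of_boundary_eq_pt h hψ (rfl : R.boundary (R.mark 1) = R.pt 1),
    ← discParam_eq_of_boundary_eq_pt h hψ (rfl : R.boundary (R.mark 2) = R.pt 2),
    image_uIcc_discParam_eq h hT hm12.le (by linarith) (by linarith), R.arc_one_eq]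

/-- **`Ψ` maps `[x 2, x 3]` onto the arc `(cd)`.** [folklore] -/
theorem image_uIcc_eq_arc_two :
    (fun y : ℝ => ψ.boundaryExtension y) '' uIcc (x 2) (x 3) = R.arc 2 := by
  obtain ⟨T, h3, h1, hT⟩ := exists_param_apply_one h hψ
  have hm02 : R.mark 0 < R.mark 2 := R.strictMono_mark (by decide)
  have hm23 : R.mark 2 < R.mark 3 := R.strictMono_mark (by decide)
  rw [← discParam_eq_of_boundary_eq_pt h hψ (rfl : R.boundary (R.mark 2) = R.pt 2),
    ← discParam_eq_of_boundary_eq_pt h hψ (rfl : R.boundary (R.mark 3) = R.pt 3),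
    image_uIcc_discParam_eq h hT hm23.le (by linarith) (by linarith), R.arc_two_eq]

/-- **Outside the open segment between `x 0` and `x 3`, `Ψ` maps into the arc `(da)`.**
[folklore] -/
theorem mem_arc_three_of_not_mem_uIoo {y : ℝ} (hy : y ∉ uIoo (x 0) (x 3)) :
    ψ.boundaryExtension y ∈ R.arc 3 := by
  obtain ⟨T, h3, h1, hT⟩ := exists_param_apply_one h hψ
  have hm03 : R.mark 0 < R.mark 3 := R.strictMono_mark (by decide)
  have hg := strictMonoOn_or_strictAntiOn h hT
  obtain ⟨t, htW, hbt, hgt⟩ := exists_mem_Ioo_discParam_eq h hT y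
  have h0W : R.mark 0 ∈ Ioo (T - 1) T := ⟨by linarith, by linarith⟩
  have h3W : R.mark 3 ∈ Ioo (T - 1) T := ⟨by linarith, h3⟩
  have ht : t ∉ Ioo (R.mark 0) (R.mark 3) := by
    rw [← mem_uIoo_iff hg h0W h3W htW hm03.le,
      discParam_eq_of_boundary_eq_pt h hψ (rfl : R.boundary (R.mark 0) = R.pt 0),
      discParam_eq_of_boundary_eq_pt h hψ (rfl : R.boundary (R.mark 3) = R.pt 3), hgt]
    exact hy
  rw [← hbt, arc_three_eq]
  rcases le_or_gt (R.mark 3) t with hle | hlt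
  · exact ⟨t, ⟨hle, by linarith [htW.2]⟩, rfl⟩
  · have ht0 : t ≤ R.mark 0 := by
      by_contra hcon
      exact ht ⟨not_le.1 hcon, hlt⟩
    exact ⟨t + 1, ⟨by linarith [htW.1], by linarith⟩, R.periodic_boundary t⟩

/-- **The boundary value at infinity lies on the arc `(da)`.** [folklore] -/
theorem apply_one_mem_arc_three : Φ 1 ∈ R.arc 3 := by
  obtain ⟨T, h3, h1, hT⟩ := exists_param_apply_one h hψ
  rw [arc_three_eq, ← hT]
  exact ⟨T, ⟨h3.le, h1.le⟩, rfl⟩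

/-- **Conversely, every point of the arc `(da)` is the boundary value at infinity or `Ψ y` for a
real `y` outside the open segment between `x 0` and `x 3`.** [folklore] -/
theorem eq_or_exists_of_mem_arc_three {q : ℂ} (hq : q ∈ R.arc 3) :
    q = Φ 1 ∨ ∃ y : ℝ, y ∉ uIoo (x 0) (x 3) ∧ ψ.boundaryExtension y = q := by
  obtain ⟨T, h3, h1, hT⟩ := exists_param_apply_one h hψ
  have hm03 : R.mark 0 < R.mark 3 := R.strictMono_mark (by decide)
  have hg := strictMonoOn_or_strictAntiOn h hT
  have h0W : R.mark 0 ∈ Ioo (T - 1) T := ⟨by linarith, by linarith⟩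
  have h3W : R.mark 3 ∈ Ioo (T - 1) T := ⟨by linarith, h3⟩
  rw [arc_three_eq] at hq
  obtain ⟨t, ht, rfl⟩ := hq
  -- the key step: a window parameter outside `(mark 0, mark 3)` is pulled back outside the segment
  have key : ∀ s ∈ Ioo (T - 1) T, s ∉ Ioo (R.mark 0) (R.mark 3) →
      R.boundary s = Φ 1 ∨ ∃ y : ℝ, y ∉ uIoo (x 0) (x 3) ∧ ψ.boundaryExtension y = R.boundary s := by
    intro s hsW hs
    refine Or.inr ⟨JordanDomain.discParam R.toJordanDomain Φ s, ?_,
      h.boundaryExtension_discParam (boundary_ne_apply_one hT hsW)⟩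
    rw [← discParam_eq_of_boundary_eq_pt h hψ (rfl : R.boundary (R.mark 0) = R.pt 0),
      ← discParam_eq_of_boundary_eq_pt h hψ (rfl : R.boundary (R.mark 3) = R.pt 3),
      mem_uIoo_iff hg h0W h3W hsW hm03.le]
    exact hs
  rcases lt_trichotomy t T with hlt | rfl | hgt
  · exact key t ⟨by linarith [ht.1], hlt⟩ fun hmem => not_lt.2 ht.1 hmem.2
  · exact Or.inl hT
  · have h' := key (t - 1) ⟨by linarith, by linarith [ht.2]⟩ fun hmem => by linarith [hmem.1, ht.2]
    rwa [R.periodic_boundary.sub_eq] at h'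

end Arcs

end UniformizingArcs

end Literature.Probability.RandomPlanarGeometry
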